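import Literature.Combinatorics.Additive.PolynomialFreimanRuzsa
import Literature.Combinatorics.Additive.EntropicBSG
import Literature.Combinatorics.Additive.EntropicRuzsaHundredPercent
import Literature.Combinatorics.Additive.PolynomialFreimanRuzsaEstimates
import Mathlib.Combinatorics.Additive.RuzsaCovering
import Mathlib.Algebra.Module.ZMod
import HarnessLib

/-!
# The polynomial Freiman–Ruzsa theorem over `𝔽₂ⁿ` (Gowers–Green–Manners–Tao): proofs

Topic `Literature/Combinatorics/Additive`. Everything in this file is PROVED; it discharges the
named fact `Literature.Combinatorics.Additive.polynomialFreimanRuzsa` (GGMT Theorem 1.2, Marton's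
conjecture with `C = 12`) as `polynomialFreimanRuzsa_holds`. Setting and notation as in
`PolynomialFreimanRuzsaEstimates` (the abstract independent quadruple `X₁, X₂, X₁', X₂'`).

## Part 1: the endgame (GGMT §7)

* `EntropicRuzsa.isTauMin_le_pair` — one ordered pair in the proof of GGMT Lemma 7.2: for
  jointly distributed `(A, B)` with `C = A + B`, the entropic BSG lemma (`ent_bsg`),
  `τ`-minimality on the fibres of `C` and Lemma 5.1 give
  `k ≤ (3 I[A:B] + 2 H[C] - H[A] - H[B]) + η (d[ρ₁;A] - d[ρ₁;μ₁]) + η (d[ρ₂;B] - d[ρ₂;μ₂])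
     + (η/2)(I[A:C] + I[B:C])` (GGMT (7.7)–(7.8), in averaged form: no fibre is selected);
* `EntropicRuzsa.isTauMin_le_triple` — **GGMT Lemma 7.2** (averaged over the six permutations):
  `T₁ + T₂ + T₃ = 0 ⇒ k ≤ δ + (η/3)(δ + ∑ᵢ ∑ⱼ (d[ρᵢ;Tⱼ] - d[ρᵢ;μᵢ]))`;
* `EntropicRuzsa.condRdist'_W_eq_W'`, `EntropicRuzsa.sum_condRdist'_le` — GGMT (7.4): the six
  applications of Lemma 7.1 bounding `∑ᵢ ∑_{A ∈ {U,V,W}} (d[ρᵢ ; A | S] - d[ρᵢ ; μᵢ])` by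
  `3 H[S] - (3/2) H[X₁] - (3/2) H[X₂]`;
* `EntropicRuzsa.dLaw_le_of_fibres` — GGMT (7.9): Lemma 7.2 applied to `(U, V, W)` (which sum
  to `0` in characteristic two, GGMT (7.5)) conditioned on `S` and averaged;
* `EntropicRuzsa.dLaw_eq_zero_of_isTauMin` — the final contradiction of §7 with `η = 1/9`
  (`8η + η² < 1`): a `τ`-minimiser realised as above has `k = 0` — GGMT Proposition 2.1 in the
  contrapositive formulation (3.8).

## Part 2: Theorem 1.8 and Theorem 1.2

* `EntropicRuzsa.dLaw_eq_zero_of_isTauMin_laws` — a `τ`-minimiser `(μ₁, μ₂)` (with `η = 1/9`)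
  has `d[μ₁ ; μ₂] = 0`: the independent quadruple `X₁, X₂, X̃₁, X̃₂` of GGMT §3 is realised as
  the coordinates of `(G × G) × (G × G)` with weights `(μ₁ ⊗ μ₂) ⊗ (μ₁ ⊗ μ₂)` and the endgame
  (`dLaw_eq_zero_of_isTauMin`) is applied;
* `EntropicRuzsa.entropic_pfr` — **GGMT Theorem 1.8** (entropic PFR): for laws `ρ₁, ρ₂` on an
  elementary abelian `2`-group there is a subgroup `H` with
  `d[ρ₁ ; U_H] + d[ρ₂ ; U_H] ≤ 11 d[ρ₁ ; ρ₂]` (minimiser by compactness, Proposition 2.1,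
  Lemma 2.2, `τ[μ₁;μ₂] ≤ τ[ρ₂;ρ₁]`, triangle inequality);
* `EntropicRuzsa.pfr_of_entropic_pfr` — **GGMT Appendix B**: entropic PFR with constant `11`
  implies PFR with `C = 12` (`d[U_A ; U_A] ≤ log K`, `|log|H| - log|A|| ≤ 11 log K`, a popular
  translate by `max_x p(x) ≥ e^{-H}` (A.2), Ruzsa covering `Finset.ruzsa_covering_add`, and for
  `|H| > |A|` a subgroup `H' ≤ H` with `|A|/2 < |H'| ≤ |A|` from
  `ZModModule.exists_submodule_subset_card_le`, again covered by Ruzsa covering) — all estimates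
  are carried out with logarithms;
* `polynomialFreimanRuzsa_holds` — the specialisation to `G = Fin n → ZMod 2`.

## References
* W. T. Gowers, B. Green, F. Manners, T. Tao, *On a conjecture of Marton*, Ann. of Math. (2)
  201 (2025), Theorem 1.2, Theorem 1.8, §2, §3 ((3.8)–(3.10)), §7, Appendix B.
-/

open Finset Real Literature.Probability.Entropy.FiniteShannon

noncomputable section

namespace Literature.Combinatorics.Additive

namespace EntropicRuzsa

universe u

variable {G : Type u} [AddCommGroup G] [Fintype G] [DecidableEq G] [Module (ZMod 2) G]
  {η : ℝ} {ρ₁ ρ₂ μ₁ μ₂ : G → ℝ}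

/-! ### GGMT Lemma 7.2 in averaged form -/

section Triple

variable {κ : Type*} {t : Finset κ} {Q : κ → ℝ}

/-- One ordered pair in the proof of GGMT Lemma 7.2: for jointly distributed `(A, B)` with
`C = A + B`, testing `τ`-minimality on the fibres `(A | C = z), (B | C = z)` and averaging
(entropic BSG, Lemma A.2, and Lemma 5.1) gives
`k ≤ (3 I[A:B] + 2 H[C] - H[A] - H[B]) + η (d[ρ₁ ; A] - d[ρ₁ ; μ₁]) + η (d[ρ₂ ; B] - d[ρ₂ ; μ₂])
   + (η/2) (I[A : C] + I[B : C])`. [cite: GowersEtAl2025, Lemma 7.2 (proof, (7.7)–(7.8))] -/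
theorem isTauMin_le_pair {A B : κ → G} (hQ : ∀ j ∈ t, 0 ≤ Q j) (ht : 0 < mass t Q)
    (hρ₁ : ρ₁ ∈ stdSimplex ℝ G) (hρ₂ : ρ₂ ∈ stdSimplex ℝ G) (hmin : IsTauMin η ρ₁ ρ₂ μ₁ μ₂)
    (hη : 0 ≤ η) :
    dLaw μ₁ μ₂ ≤ (3 * mutualInfo t Q A B + 2 * ent t Q (fun j => A j + B j) - ent t Q A - ent t Q B)
      + η * (rdist univ ρ₁ id t Q A - dLaw ρ₁ μ₁) + η * (rdist univ ρ₂ id t Q B - dLaw ρ₂ μ₂)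
      + η / 2 * (mutualInfo t Q A (fun j => A j + B j) + mutualInfo t Q B (fun j => A j + B j)) := by
  have hw₁ := stdSimplex_nonneg hρ₁
  have hw₂ := stdSimplex_nonneg hρ₂
  have hs₁ := mass_univ_pos_of_mem_stdSimplex hρ₁
  have hs₂ := mass_univ_pos_of_mem_stdSimplex hρ₂
  set C : κ → G := fun j => A j + B j with hC
  -- entropic BSG
  have bsg := ent_bsg (A := A) (B := B) hQ ht
  -- `τ`-minimality on the fibres, averaged over `z` with weights `P(C = z)`
  have hC1 : ∑ z ∈ t.image C, prob t Q C z = 1 := sum_prob_eq_one ht subset_rfl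
  have diag : dLaw μ₁ μ₂ - η * (condRdist' univ ρ₁ id t Q A C - dLaw ρ₁ μ₁) -
      η * (condRdist' univ ρ₂ id t Q B C - dLaw ρ₂ μ₂) ≤
      ∑ z ∈ t.image C, prob t Q C z *
        rdist (t.filter fun j => C j = z) Q A (t.filter fun j => C j = z) Q B := by
    have eL : dLaw μ₁ μ₂ - η * (condRdist' univ ρ₁ id t Q A C - dLaw ρ₁ μ₁) -
        η * (condRdist' univ ρ₂ id t Q B C - dLaw ρ₂ μ₂) =
        ∑ z ∈ t.image C, prob t Q C z * (dLaw μ₁ μ₂ -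
          η * (rdist univ ρ₁ id (t.filter fun j => C j = z) Q A - dLaw ρ₁ μ₁) -
          η * (rdist univ ρ₂ id (t.filter fun j => C j = z) Q B - dLaw ρ₂ μ₂)) := by
      have hc : ∀ c : ℝ, ∑ z ∈ t.image C, prob t Q C z * c = c := fun c => by
        rw [← sum_mul, hC1, one_mul]
      have hterm : ∀ z, prob t Q C z * (dLaw μ₁ μ₂ -
          η * (rdist univ ρ₁ id (t.filter fun j => C j = z) Q A - dLaw ρ₁ μ₁) -
          η * (rdist univ ρ₂ id (t.filter fun j => C j = z) Q B - dLaw ρ₂ μ₂)) =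
          prob t Q C z * dLaw μ₁ μ₂ -
          η * (prob t Q C z * rdist univ ρ₁ id (t.filter fun j => C j = z) Q A) +
          η * (prob t Q C z * dLaw ρ₁ μ₁) -
          η * (prob t Q C z * rdist univ ρ₂ id (t.filter fun j => C j = z) Q B) +
          η * (prob t Q C z * dLaw ρ₂ μ₂) := fun z => by ring
      simp only [hterm, sum_add_distrib, sum_sub_distrib]
      simp only [← mul_sum]
      rw [hc, hc, hc, condRdist'_def, condRdist'_def]
      ring
    rw [eL]
    refine sum_le_sum fun z _ => ?_
    rcases (prob_nonneg hQ z : 0 ≤ prob t Q C z).eq_or_lt with hz | hz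
    · rw [← hz]; simp
    refine mul_le_mul_of_nonneg_left ?_ hz.le
    have hQz : ∀ j ∈ t.filter (fun j => C j = z), 0 ≤ Q j :=
      fun j hj => hQ j (mem_of_mem_filter j hj)
    exact hmin.le_rdist hρ₁ hρ₂ A B hQz (mass_fiber_pos_of_prob_pos hQ hz) hQz
      (mass_fiber_pos_of_prob_pos hQ hz)
  -- Lemma 5.1 twice
  have l₁ := condRdist'_le (id : G → G) A C hw₁ hs₁ hQ ht
  have l₂ := condRdist'_le (id : G → G) B C hw₂ hs₂ hQ ht
  have l₁' := mul_le_mul_of_nonneg_left l₁ hη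
  have l₂' := mul_le_mul_of_nonneg_left l₂ hη
  linarith

/-- **GGMT Lemma 7.2** (averaged form): if `(T₁, T₂, T₃)` is `G³`-valued with `T₁ + T₂ + T₃ = 0`
identically and `δ = I[T₁:T₂] + I[T₂:T₃] + I[T₃:T₁]`, then testing `τ`-minimality on the six
conditioned pairs gives `k ≤ δ + (η/3) (δ + ∑_{i=1,2} ∑_{j=1,2,3} (d[ρᵢ ; Tⱼ] - d[ρᵢ ; μᵢ]))`.
[cite: GowersEtAl2025, Lemma 7.2] -/
theorem isTauMin_le_triple {T₁ T₂ T₃ : κ → G} (hQ : ∀ j ∈ t, 0 ≤ Q j) (ht : 0 < mass t Q)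
    (hsum : ∀ j ∈ t, T₁ j + T₂ j + T₃ j = 0)
    (hρ₁ : ρ₁ ∈ stdSimplex ℝ G) (hρ₂ : ρ₂ ∈ stdSimplex ℝ G) (hmin : IsTauMin η ρ₁ ρ₂ μ₁ μ₂)
    (hη : 0 ≤ η) :
    dLaw μ₁ μ₂ ≤ (mutualInfo t Q T₁ T₂ + mutualInfo t Q T₂ T₃ + mutualInfo t Q T₃ T₁) +
      η / 3 * ((mutualInfo t Q T₁ T₂ + mutualInfo t Q T₂ T₃ + mutualInfo t Q T₃ T₁) +
        ((rdist univ ρ₁ id t Q T₁ - dLaw ρ₁ μ₁) + (rdist univ ρ₁ id t Q T₂ - dLaw ρ₁ μ₁) +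
          (rdist univ ρ₁ id t Q T₃ - dLaw ρ₁ μ₁) + (rdist univ ρ₂ id t Q T₁ - dLaw ρ₂ μ₂) +
          (rdist univ ρ₂ id t Q T₂ - dLaw ρ₂ μ₂) + (rdist univ ρ₂ id t Q T₃ - dLaw ρ₂ μ₂))) := by
  -- pairwise sums are the third variable
  have e12 : ∀ j ∈ t, T₁ j + T₂ j = T₃ j := fun j hj => by
    linear_combination (norm := abel) hsum j hj - add_self_char2 (T₃ j)
  have e21 : ∀ j ∈ t, T₂ j + T₁ j = T₃ j := fun j hj => by
    linear_combination (norm := abel) hsum j hj - add_self_char2 (T₃ j)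
  have e13 : ∀ j ∈ t, T₁ j + T₃ j = T₂ j := fun j hj => by
    linear_combination (norm := abel) hsum j hj - add_self_char2 (T₂ j)
  have e31 : ∀ j ∈ t, T₃ j + T₁ j = T₂ j := fun j hj => by
    linear_combination (norm := abel) hsum j hj - add_self_char2 (T₂ j)
  have e23 : ∀ j ∈ t, T₂ j + T₃ j = T₁ j := fun j hj => by
    linear_combination (norm := abel) hsum j hj - add_self_char2 (T₁ j)
  have e32 : ∀ j ∈ t, T₃ j + T₂ j = T₁ j := fun j hj => by
    linear_combination (norm := abel) hsum j hj - add_self_char2 (T₁ j)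
  -- the six ordered pairs
  have p12 := isTauMin_le_pair (A := T₁) (B := T₂) hQ ht hρ₁ hρ₂ hmin hη
  have p21 := isTauMin_le_pair (A := T₂) (B := T₁) hQ ht hρ₁ hρ₂ hmin hη
  have p13 := isTauMin_le_pair (A := T₁) (B := T₃) hQ ht hρ₁ hρ₂ hmin hη
  have p31 := isTauMin_le_pair (A := T₃) (B := T₁) hQ ht hρ₁ hρ₂ hmin hη
  have p23 := isTauMin_le_pair (A := T₂) (B := T₃) hQ ht hρ₁ hρ₂ hmin hη
  have p32 := isTauMin_le_pair (A := T₃) (B := T₂) hQ ht hρ₁ hρ₂ hmin hη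
  rw [ent_congr e12, mutualInfo_congr (fun _ _ => rfl) e12, mutualInfo_congr (fun _ _ => rfl) e12]
    at p12
  rw [ent_congr e21, mutualInfo_congr (fun _ _ => rfl) e21, mutualInfo_congr (fun _ _ => rfl) e21]
    at p21
  rw [ent_congr e13, mutualInfo_congr (fun _ _ => rfl) e13, mutualInfo_congr (fun _ _ => rfl) e13]
    at p13
  rw [ent_congr e31, mutualInfo_congr (fun _ _ => rfl) e31, mutualInfo_congr (fun _ _ => rfl) e31]
    at p31
  rw [ent_congr e23, mutualInfo_congr (fun _ _ => rfl) e23, mutualInfo_congr (fun _ _ => rfl) e23]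
    at p23
  rw [ent_congr e32, mutualInfo_congr (fun _ _ => rfl) e32, mutualInfo_congr (fun _ _ => rfl) e32]
    at p32
  -- everything in terms of `H[T₁], H[T₂], H[T₃]` and the common pair entropy `J`
  have J21 : ent t Q (fun j => (T₂ j, T₁ j)) = ent t Q (fun j => (T₁ j, T₂ j)) := ent_pair_comm
  have J13 : ent t Q (fun j => (T₁ j, T₃ j)) = ent t Q (fun j => (T₁ j, T₂ j)) := by
    refine ent_eq_of_determines hQ fun i hi j hj => ?_
    simp only [Prod.mk.injEq]
    constructor
    · rintro ⟨ha, hb⟩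
      exact ⟨ha, by linear_combination (norm := abel) hsum i hi - hsum j hj - ha - hb⟩
    · rintro ⟨ha, hb⟩
      exact ⟨ha, by linear_combination (norm := abel) hsum i hi - hsum j hj - ha - hb⟩
  have J31 : ent t Q (fun j => (T₃ j, T₁ j)) = ent t Q (fun j => (T₁ j, T₂ j)) := by
    rw [ent_pair_comm, J13]
  have J23 : ent t Q (fun j => (T₂ j, T₃ j)) = ent t Q (fun j => (T₁ j, T₂ j)) := by
    refine ent_eq_of_determines hQ fun i hi j hj => ?_
    simp only [Prod.mk.injEq]
    constructor
    · rintro ⟨ha, hb⟩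
      exact ⟨by linear_combination (norm := abel) hsum i hi - hsum j hj - ha - hb, ha⟩
    · rintro ⟨ha, hb⟩
      exact ⟨hb, by linear_combination (norm := abel) hsum i hi - hsum j hj - ha - hb⟩
  have J32 : ent t Q (fun j => (T₃ j, T₂ j)) = ent t Q (fun j => (T₁ j, T₂ j)) := by
    rw [ent_pair_comm, J23]
  simp only [mutualInfo_def] at p12 p21 p13 p31 p23 p32 ⊢
  simp only [J21, J13, J31, J23, J32] at p12 p21 p13 p31 p23 p32 ⊢
  linarith

end Triple

/-! ### The distance bounds (GGMT (7.4)) -/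

section Setting

variable {ι : Type*} {s : Finset ι} {P : ι → ℝ} {X₁ X₂ X₁' X₂' : ι → G}

/-- In the setting of §7: `d[X₂⁰ ; W | S] = d[X₂⁰ ; W' | S]` for `W = X₁ + X₁'`, `W' = X₂ + X₂'`,
since on each fibre `{S = s}` one has `W' = W + s` (GGMT §7, before (7.4)).
[cite: GowersEtAl2025, §7 (proof of (7.4))] -/
theorem condRdist'_W_eq_W' {ρ : G → ℝ} :
    condRdist' univ ρ id s P (fun ω => X₁ ω + X₁' ω) (fun ω => X₁ ω + X₂ ω + X₁' ω + X₂' ω) =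
      condRdist' univ ρ id s P (fun ω => X₂ ω + X₂' ω) (fun ω => X₁ ω + X₂ ω + X₁' ω + X₂' ω) := by
  rw [condRdist'_def, condRdist'_def]
  refine sum_congr rfl fun c _ => ?_
  congr 1
  have h : ∀ ω ∈ s.filter (fun ω => X₁ ω + X₂ ω + X₁' ω + X₂' ω = c),
      X₂ ω + X₂' ω = (X₁ ω + X₁' ω) + c := by
    intro ω hω
    have := (mem_filter.1 hω).2
    linear_combination (norm := abel) this - add_self_char2 (X₁ ω) - add_self_char2 (X₁' ω)
  rw [rdist_congr (fun _ _ => rfl) h, rdist_add_const]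

/-- **GGMT (7.4)**, first inequality: the sum over `i = 1, 2` and `A ∈ {U, V, W}` of
`d[Xᵢ⁰ ; A | S] - d[Xᵢ⁰ ; Xᵢ]` is at most `3 H[S] - (3/2) H[X₁] - (3/2) H[X₂]` (six applications
of Lemma 7.1). [cite: GowersEtAl2025, §7 (7.4)] -/
theorem sum_condRdist'_le (hP : ∀ ω ∈ s, 0 ≤ P ω) (hs : 0 < mass s P)
    (l₁ : prob s P X₁ = μ₁) (l₂ : prob s P X₂ = μ₂) (l₁' : prob s P X₁' = μ₁)
    (l₂' : prob s P X₂' = μ₂)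
    (iA : IndepRV s P (fun ω => (X₁ ω, X₂ ω)) (fun ω => (X₁' ω, X₂' ω)))
    (iB : IndepRV s P (fun ω => (X₁ ω, X₂' ω)) (fun ω => (X₂ ω, X₁' ω)))
    (iC : IndepRV s P (fun ω => (X₁ ω, X₁' ω)) (fun ω => (X₂ ω, X₂' ω)))
    (hρ₁ : ρ₁ ∈ stdSimplex ℝ G) (hρ₂ : ρ₂ ∈ stdSimplex ℝ G) :
    (condRdist' univ ρ₁ id s P (fun ω => X₁ ω + X₂ ω) (fun ω => X₁ ω + X₂ ω + X₁' ω + X₂' ω)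
        - dLaw ρ₁ μ₁) +
      (condRdist' univ ρ₁ id s P (fun ω => X₁' ω + X₂ ω) (fun ω => X₁ ω + X₂ ω + X₁' ω + X₂' ω)
        - dLaw ρ₁ μ₁) +
      (condRdist' univ ρ₁ id s P (fun ω => X₁ ω + X₁' ω) (fun ω => X₁ ω + X₂ ω + X₁' ω + X₂' ω)
        - dLaw ρ₁ μ₁) +
      (condRdist' univ ρ₂ id s P (fun ω => X₁ ω + X₂ ω) (fun ω => X₁ ω + X₂ ω + X₁' ω + X₂' ω)
        - dLaw ρ₂ μ₂) +
      (condRdist' univ ρ₂ id s P (fun ω => X₁' ω + X₂ ω) (fun ω => X₁ ω + X₂ ω + X₁' ω + X₂' ω)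
        - dLaw ρ₂ μ₂) +
      (condRdist' univ ρ₂ id s P (fun ω => X₁ ω + X₁' ω) (fun ω => X₁ ω + X₂ ω + X₁' ω + X₂' ω)
        - dLaw ρ₂ μ₂) ≤
    3 * ent s P (fun ω => X₁ ω + X₂ ω + X₁' ω + X₂' ω) - 3 / 2 * entFun μ₁ - 3 / 2 * entFun μ₂ := by
  have hw₁ := stdSimplex_nonneg hρ₁
  have hw₂ := stdSimplex_nonneg hρ₂
  have hs₁ := mass_univ_pos_of_mem_stdSimplex hρ₁
  have hs₂ := mass_univ_pos_of_mem_stdSimplex hρ₂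
  -- pairwise independence
  have i12 : IndepRV s P X₁ X₂ := iB.comp Prod.fst Prod.fst
  have i21 : IndepRV s P X₂ X₁ := i12.symm
  have i1'2 : IndepRV s P X₁' X₂ := (iA.comp Prod.snd Prod.fst).symm
  have i21' : IndepRV s P X₂ X₁' := iA.comp Prod.snd Prod.fst
  have i11' : IndepRV s P X₁ X₁' := iA.comp Prod.fst Prod.fst
  have i22' : IndepRV s P X₂ X₂' := iA.comp Prod.snd Prod.snd
  have i12' : IndepRV s P X₁ X₂' := iA.comp Prod.fst Prod.snd
  have i1'2' : IndepRV s P X₁' X₂' := (iB.comp Prod.snd Prod.snd).symm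
  -- independence of sums
  have jA : IndepRV s P (fun ω => X₁ ω + X₂ ω) (fun ω => X₁' ω + X₂' ω) :=
    iA.comp (fun p => p.1 + p.2) (fun p => p.1 + p.2)
  have jA' : IndepRV s P (fun ω => X₂ ω + X₁ ω) (fun ω => X₁' ω + X₂' ω) :=
    iA.comp (fun p => p.2 + p.1) (fun p => p.1 + p.2)
  have jB : IndepRV s P (fun ω => X₁' ω + X₂ ω) (fun ω => X₁ ω + X₂' ω) :=
    iB.symm.comp (fun p => p.2 + p.1) (fun p => p.1 + p.2)
  have jB' : IndepRV s P (fun ω => X₂ ω + X₁' ω) (fun ω => X₁ ω + X₂' ω) :=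
    iB.symm.comp (fun p => p.1 + p.2) (fun p => p.1 + p.2)
  have jC : IndepRV s P (fun ω => X₁ ω + X₁' ω) (fun ω => X₂ ω + X₂' ω) :=
    iC.comp (fun p => p.1 + p.2) (fun p => p.1 + p.2)
  -- laws and entropies
  have eX₁ : ent s P X₁ = entFun μ₁ := by rw [ent_eq_entFun, l₁]
  have eX₂ : ent s P X₂ = entFun μ₂ := by rw [ent_eq_entFun, l₂]
  have eX₁' : ent s P X₁' = entFun μ₁ := by rw [ent_eq_entFun, l₁']
  have r₁ : rdist univ ρ₁ id s P X₁ = dLaw ρ₁ μ₁ := by rw [rdist_univ_id hρ₁, l₁]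
  have r₁' : rdist univ ρ₁ id s P X₁' = dLaw ρ₁ μ₁ := by rw [rdist_univ_id hρ₁, l₁']
  have r₂ : rdist univ ρ₂ id s P X₂ = dLaw ρ₂ μ₂ := by rw [rdist_univ_id hρ₂, l₂]
  have eU : ent s P (fun ω => X₁ ω + X₂ ω) = dLaw μ₁ μ₂ + entFun μ₁ / 2 + entFun μ₂ / 2 :=
    ent_add_eq_of_laws i12 l₁ l₂
  have eU' : ent s P (fun ω => X₂ ω + X₁ ω) = dLaw μ₁ μ₂ + entFun μ₁ / 2 + entFun μ₂ / 2 := by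
    rw [ent_add_eq_of_laws i21 l₂ l₁, dLaw_comm]; ring
  have eV : ent s P (fun ω => X₁' ω + X₂ ω) = dLaw μ₁ μ₂ + entFun μ₁ / 2 + entFun μ₂ / 2 :=
    ent_add_eq_of_laws i1'2 l₁' l₂
  have eV' : ent s P (fun ω => X₂ ω + X₁' ω) = dLaw μ₁ μ₂ + entFun μ₁ / 2 + entFun μ₂ / 2 := by
    rw [ent_add_eq_of_laws i21' l₂ l₁', dLaw_comm]; ring
  have eZ : ent s P (fun ω => X₁' ω + X₂' ω) = dLaw μ₁ μ₂ + entFun μ₁ / 2 + entFun μ₂ / 2 :=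
    ent_add_eq_of_laws i1'2' l₁' l₂'
  have eZ' : ent s P (fun ω => X₁ ω + X₂' ω) = dLaw μ₁ μ₂ + entFun μ₁ / 2 + entFun μ₂ / 2 :=
    ent_add_eq_of_laws i12' l₁ l₂'
  -- `S` in the various orders
  have sa : ∀ ω ∈ s, X₁ ω + X₂ ω + (X₁' ω + X₂' ω) = X₁ ω + X₂ ω + X₁' ω + X₂' ω :=
    fun _ _ => by abel
  have sb : ∀ ω ∈ s, X₂ ω + X₁ ω + (X₁' ω + X₂' ω) = X₁ ω + X₂ ω + X₁' ω + X₂' ω :=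
    fun _ _ => by abel
  have sc : ∀ ω ∈ s, X₁' ω + X₂ ω + (X₁ ω + X₂' ω) = X₁ ω + X₂ ω + X₁' ω + X₂' ω :=
    fun _ _ => by abel
  have sd : ∀ ω ∈ s, X₂ ω + X₁' ω + (X₁ ω + X₂' ω) = X₁ ω + X₂ ω + X₁' ω + X₂' ω :=
    fun _ _ => by abel
  have se : ∀ ω ∈ s, X₁ ω + X₁' ω + (X₂ ω + X₂' ω) = X₁ ω + X₂ ω + X₁' ω + X₂' ω :=
    fun _ _ => by abel
  have sf : ∀ ω ∈ s, X₂ ω + X₂' ω + (X₁ ω + X₁' ω) = X₁ ω + X₂ ω + X₁' ω + X₂' ω :=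
    fun _ _ => by abel
  -- the six applications of Lemma 7.1
  have a := condRdist'_sub_rdist_le_of_indep₃ (id : G → G) i12 jA hw₁ hs₁ hP hs
  have b := condRdist'_sub_rdist_le_of_indep₃ (id : G → G) i21 jA' hw₂ hs₂ hP hs
  have c := condRdist'_sub_rdist_le_of_indep₃ (id : G → G) i1'2 jB hw₁ hs₁ hP hs
  have d := condRdist'_sub_rdist_le_of_indep₃ (id : G → G) i21' jB' hw₂ hs₂ hP hs
  have e := condRdist'_sub_rdist_le_of_indep₃ (id : G → G) i11' jC hw₁ hs₁ hP hs
  have f := condRdist'_sub_rdist_le_of_indep₃ (id : G → G) i22' jC.symm hw₂ hs₂ hP hs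
  rw [condRdist'_congr (fun _ _ => rfl) (fun _ _ => rfl) sa, ent_congr sa, r₁, eU, eX₁, eZ] at a
  rw [condRdist'_congr (fun _ _ => rfl) (fun ω _ => add_comm (X₂ ω) (X₁ ω)) sb, ent_congr sb, r₂,
    eU', eX₂, eZ] at b
  rw [condRdist'_congr (fun _ _ => rfl) (fun _ _ => rfl) sc, ent_congr sc, r₁', eV, eX₁', eZ'] at c
  rw [condRdist'_congr (fun _ _ => rfl) (fun ω _ => add_comm (X₂ ω) (X₁' ω)) sd, ent_congr sd, r₂,
    eV', eX₂, eZ'] at d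
  rw [condRdist'_congr (fun _ _ => rfl) (fun _ _ => rfl) se, ent_congr se, r₁, eX₁] at e
  rw [condRdist'_congr (fun _ _ => rfl) (fun _ _ => rfl) sf, ent_congr sf, r₂, eX₂,
    ← condRdist'_W_eq_W'] at f
  linarith

/-! ### Conditioning on `S` and the final contradiction (GGMT (7.9) and the end of §7) -/

/-- **GGMT (7.9)**: applying Lemma 7.2 to `(U, V, W)` conditioned on `S = s` and averaging over `s`:
`k ≤ δ~ + (η/3) (δ~ + ∑ᵢ ∑_{A ∈ {U,V,W}} (d[Xᵢ⁰ ; A | S] - d[Xᵢ⁰ ; Xᵢ]))` with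
`δ~ = I[U:V|S] + I[V:W|S] + I[W:U|S]`. [cite: GowersEtAl2025, §7 (7.9)] -/
theorem dLaw_le_of_fibres (hP : ∀ ω ∈ s, 0 ≤ P ω) (hs : 0 < mass s P)
    (hρ₁ : ρ₁ ∈ stdSimplex ℝ G) (hρ₂ : ρ₂ ∈ stdSimplex ℝ G) (hmin : IsTauMin η ρ₁ ρ₂ μ₁ μ₂)
    (hη : 0 ≤ η) :
    dLaw μ₁ μ₂ ≤
      (condMutualInfo s P (fun ω => X₁ ω + X₂ ω) (fun ω => X₁' ω + X₂ ω)
          (fun ω => X₁ ω + X₂ ω + X₁' ω + X₂' ω) +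
        condMutualInfo s P (fun ω => X₁' ω + X₂ ω) (fun ω => X₁ ω + X₁' ω)
          (fun ω => X₁ ω + X₂ ω + X₁' ω + X₂' ω) +
        condMutualInfo s P (fun ω => X₁ ω + X₁' ω) (fun ω => X₁ ω + X₂ ω)
          (fun ω => X₁ ω + X₂ ω + X₁' ω + X₂' ω)) +
      η / 3 * ((condMutualInfo s P (fun ω => X₁ ω + X₂ ω) (fun ω => X₁' ω + X₂ ω)
          (fun ω => X₁ ω + X₂ ω + X₁' ω + X₂' ω) +
        condMutualInfo s P (fun ω => X₁' ω + X₂ ω) (fun ω => X₁ ω + X₁' ω)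
          (fun ω => X₁ ω + X₂ ω + X₁' ω + X₂' ω) +
        condMutualInfo s P (fun ω => X₁ ω + X₁' ω) (fun ω => X₁ ω + X₂ ω)
          (fun ω => X₁ ω + X₂ ω + X₁' ω + X₂' ω)) +
       ((condRdist' univ ρ₁ id s P (fun ω => X₁ ω + X₂ ω) (fun ω => X₁ ω + X₂ ω + X₁' ω + X₂' ω)
          - dLaw ρ₁ μ₁) +
        (condRdist' univ ρ₁ id s P (fun ω => X₁' ω + X₂ ω) (fun ω => X₁ ω + X₂ ω + X₁' ω + X₂' ω)
          - dLaw ρ₁ μ₁) +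
        (condRdist' univ ρ₁ id s P (fun ω => X₁ ω + X₁' ω) (fun ω => X₁ ω + X₂ ω + X₁' ω + X₂' ω)
          - dLaw ρ₁ μ₁) +
        (condRdist' univ ρ₂ id s P (fun ω => X₁ ω + X₂ ω) (fun ω => X₁ ω + X₂ ω + X₁' ω + X₂' ω)
          - dLaw ρ₂ μ₂) +
        (condRdist' univ ρ₂ id s P (fun ω => X₁' ω + X₂ ω) (fun ω => X₁ ω + X₂ ω + X₁' ω + X₂' ω)
          - dLaw ρ₂ μ₂) +
        (condRdist' univ ρ₂ id s P (fun ω => X₁ ω + X₁' ω) (fun ω => X₁ ω + X₂ ω + X₁' ω + X₂' ω)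
          - dLaw ρ₂ μ₂))) := by
  set U : ι → G := fun ω => X₁ ω + X₂ ω with hU
  set V : ι → G := fun ω => X₁' ω + X₂ ω with hV
  set W : ι → G := fun ω => X₁ ω + X₁' ω with hW
  set S : ι → G := fun ω => X₁ ω + X₂ ω + X₁' ω + X₂' ω with hS
  have hS1 : ∑ c ∈ s.image S, prob s P S c = 1 := sum_prob_eq_one hs subset_rfl
  have hUVW : ∀ ω ∈ s, U ω + V ω + W ω = 0 := fun ω _ => by
    simp only [hU, hV, hW]
    linear_combination (norm := abel) add_self_char2 (X₁ ω) + add_self_char2 (X₂ ω) +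
      add_self_char2 (X₁' ω)
  -- fibrewise Lemma 7.2, weighted by `P(S = c)`
  set F : G → Finset ι := fun c => s.filter fun ω => S ω = c with hF
  have key : ∀ c ∈ s.image S, prob s P S c * dLaw μ₁ μ₂ ≤ prob s P S c *
      ((mutualInfo (F c) P U V + mutualInfo (F c) P V W + mutualInfo (F c) P W U) +
        η / 3 * ((mutualInfo (F c) P U V + mutualInfo (F c) P V W + mutualInfo (F c) P W U) +
          ((rdist univ ρ₁ id (F c) P U - dLaw ρ₁ μ₁) + (rdist univ ρ₁ id (F c) P V - dLaw ρ₁ μ₁) +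
            (rdist univ ρ₁ id (F c) P W - dLaw ρ₁ μ₁) + (rdist univ ρ₂ id (F c) P U - dLaw ρ₂ μ₂) +
            (rdist univ ρ₂ id (F c) P V - dLaw ρ₂ μ₂) + (rdist univ ρ₂ id (F c) P W - dLaw ρ₂ μ₂)))) := by
    intro c _
    rcases (prob_nonneg hP c : 0 ≤ prob s P S c).eq_or_lt with hc | hc
    · rw [← hc, zero_mul, zero_mul]
    refine mul_le_mul_of_nonneg_left ?_ hc.le
    have hQ : ∀ ω ∈ F c, 0 ≤ P ω := fun ω hω => hP ω (mem_of_mem_filter ω hω)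
    exact isTauMin_le_triple hQ (mass_fiber_pos_of_prob_pos hP hc)
      (fun ω hω => hUVW ω (mem_of_mem_filter ω hω)) hρ₁ hρ₂ hmin hη
  have hsum := sum_le_sum key
  rw [← sum_mul, hS1, one_mul] at hsum
  refine hsum.trans (le_of_eq ?_)
  -- identify the averaged right-hand side
  have hterm : ∀ c, prob s P S c *
      ((mutualInfo (F c) P U V + mutualInfo (F c) P V W + mutualInfo (F c) P W U) +
        η / 3 * ((mutualInfo (F c) P U V + mutualInfo (F c) P V W + mutualInfo (F c) P W U) +
          ((rdist univ ρ₁ id (F c) P U - dLaw ρ₁ μ₁) + (rdist univ ρ₁ id (F c) P V - dLaw ρ₁ μ₁) +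
            (rdist univ ρ₁ id (F c) P W - dLaw ρ₁ μ₁) + (rdist univ ρ₂ id (F c) P U - dLaw ρ₂ μ₂) +
            (rdist univ ρ₂ id (F c) P V - dLaw ρ₂ μ₂) + (rdist univ ρ₂ id (F c) P W - dLaw ρ₂ μ₂)))) =
      prob s P S c * mutualInfo (F c) P U V + prob s P S c * mutualInfo (F c) P V W +
        prob s P S c * mutualInfo (F c) P W U +
      η / 3 * (prob s P S c * mutualInfo (F c) P U V) +
        η / 3 * (prob s P S c * mutualInfo (F c) P V W) +
        η / 3 * (prob s P S c * mutualInfo (F c) P W U) +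
      η / 3 * (prob s P S c * rdist univ ρ₁ id (F c) P U) +
        η / 3 * (prob s P S c * rdist univ ρ₁ id (F c) P V) +
        η / 3 * (prob s P S c * rdist univ ρ₁ id (F c) P W) +
        η / 3 * (prob s P S c * rdist univ ρ₂ id (F c) P U) +
        η / 3 * (prob s P S c * rdist univ ρ₂ id (F c) P V) +
        η / 3 * (prob s P S c * rdist univ ρ₂ id (F c) P W) -
      η * (prob s P S c * dLaw ρ₁ μ₁) - η * (prob s P S c * dLaw ρ₂ μ₂) := fun c => by ring
  simp only [hterm, sum_add_distrib, sum_sub_distrib]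
  simp only [← mul_sum]
  rw [← sum_mul, ← sum_mul, hS1, one_mul, one_mul]
  simp only [hF, ← condMutualInfo_def, ← condRdist'_def]
  ring

/-- **GGMT Proposition 2.1 in contrapositive form** (end of §7): if `(μ₁, μ₂)` minimises `τ`
with `η = 1/9`, realised with independent copies as above, then `k = d[μ₁ ; μ₂] = 0`.
[cite: GowersEtAl2025, Proposition 2.1 and §7] -/
theorem dLaw_eq_zero_of_isTauMin (hP : ∀ ω ∈ s, 0 ≤ P ω) (hs : 0 < mass s P)
    (l₁ : prob s P X₁ = μ₁) (l₂ : prob s P X₂ = μ₂) (l₁' : prob s P X₁' = μ₁)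
    (l₂' : prob s P X₂' = μ₂)
    (iA : IndepRV s P (fun ω => (X₁ ω, X₂ ω)) (fun ω => (X₁' ω, X₂' ω)))
    (iB : IndepRV s P (fun ω => (X₁ ω, X₂' ω)) (fun ω => (X₂ ω, X₁' ω)))
    (iC : IndepRV s P (fun ω => (X₁ ω, X₁' ω)) (fun ω => (X₂ ω, X₂' ω)))
    (hρ₁ : ρ₁ ∈ stdSimplex ℝ G) (hρ₂ : ρ₂ ∈ stdSimplex ℝ G)
    (hmin : IsTauMin (1 / 9 : ℝ) ρ₁ ρ₂ μ₁ μ₂) : dLaw μ₁ μ₂ = 0 := by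
  have hη : (0 : ℝ) ≤ 1 / 9 := by norm_num
  have hη1 : (1 / 9 : ℝ) < 1 := by norm_num
  -- `k ≥ 0`
  have hk0 : 0 ≤ dLaw μ₁ μ₂ := by
    have := rdist_nonneg X₁ X₂ hP hs hP hs
    rwa [rdist_def, l₁, l₂] at this
  -- first estimate, second estimate (twice, the second time with `X₁ ↔ X₁'`)
  have h1 := first_estimate hP hs l₁ l₂ l₁' l₂' iA iB hρ₁ hρ₂ hmin hη
  have h2 := second_estimate hP hs l₁ l₂ l₁' l₂' iA iB iC hρ₁ hρ₂ hmin hη hη1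
  have iA' : IndepRV s P (fun ω => (X₁' ω, X₂ ω)) (fun ω => (X₁ ω, X₂' ω)) :=
    iB.symm.comp Prod.swap id
  have iB' : IndepRV s P (fun ω => (X₁' ω, X₂' ω)) (fun ω => (X₂ ω, X₁ ω)) :=
    iA.symm.comp id Prod.swap
  have iC' : IndepRV s P (fun ω => (X₁' ω, X₁ ω)) (fun ω => (X₂ ω, X₂' ω)) :=
    iC.comp Prod.swap id
  have h3 := second_estimate hP hs l₁' l₂ l₁ l₂' iA' iB' iC' hρ₁ hρ₂ hmin hη hη1
  have hS' : ∀ ω ∈ s, X₁' ω + X₂ ω + X₁ ω + X₂' ω = X₁ ω + X₂ ω + X₁' ω + X₂' ω :=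
    fun _ _ => by abel
  have e1 : condMutualInfo s P (fun ω => X₁' ω + X₂ ω) (fun ω => X₁ ω + X₂ ω)
      (fun ω => X₁' ω + X₂ ω + X₁ ω + X₂' ω) =
      condMutualInfo s P (fun ω => X₁ ω + X₂ ω) (fun ω => X₁' ω + X₂ ω)
        (fun ω => X₁ ω + X₂ ω + X₁' ω + X₂' ω) := by
    rw [condMutualInfo_congr (fun _ _ => rfl) (fun _ _ => rfl) hS', condMutualInfo_comm]
  have e3 : condMutualInfo s P (fun ω => X₁' ω + X₂ ω) (fun ω => X₁' ω + X₁ ω)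
      (fun ω => X₁' ω + X₂ ω + X₁ ω + X₂' ω) =
      condMutualInfo s P (fun ω => X₁' ω + X₂ ω) (fun ω => X₁ ω + X₁' ω)
        (fun ω => X₁ ω + X₂ ω + X₁' ω + X₂' ω) :=
    condMutualInfo_congr (fun _ _ => rfl) (fun ω _ => add_comm (X₁' ω) (X₁ ω)) hS'
  rw [e1, e3] at h3
  -- `I[W : U | S] = I[U : W | S]`
  have e2 : condMutualInfo s P (fun ω => X₁ ω + X₁' ω) (fun ω => X₁ ω + X₂ ω)
      (fun ω => X₁ ω + X₂ ω + X₁' ω + X₂' ω) =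
      condMutualInfo s P (fun ω => X₁ ω + X₂ ω) (fun ω => X₁ ω + X₁' ω)
        (fun ω => X₁ ω + X₂ ω + X₁' ω + X₂' ω) := condMutualInfo_comm
  -- the entropy bound (5.10), the distance bound (7.4), the fibre inequality (7.9)
  have hS := ent_sum_four_le hP hs l₁ l₂ l₁' l₂' iA iB hρ₁ hρ₂ hmin hη
  have hD := sum_condRdist'_le hP hs l₁ l₂ l₁' l₂' iA iB iC hρ₁ hρ₂
  have hF := dLaw_le_of_fibres (X₁ := X₁) (X₂ := X₂) (X₁' := X₁') (X₂' := X₂') hP hs hρ₁ hρ₂ hmin hη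
  rw [e2] at hF
  -- nonnegativity of the conditional mutual informations
  have n1 := condMutualInfo_nonneg (X := fun ω => X₁ ω + X₂ ω) (Y := fun ω => X₁' ω + X₂ ω)
    (Z := fun ω => X₁ ω + X₂ ω + X₁' ω + X₂' ω) hP
  -- arithmetic with `η = 1/9`
  norm_num at h1 h2 h3 hS hF
  nlinarith [h1, h2, h3, hS, hD, hF, hk0, n1]

end Setting

end EntropicRuzsa

end Literature.Combinatorics.Additive

end


open Finset Real Literature.Probability.Entropy.FiniteShannon

noncomputable section

namespace Literature.Combinatorics.Additive

namespace EntropicRuzsa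

universe u


/-- The uniform law on a finite set `A`: `P(x) = 𝟙[x ∈ A] / |A|`. [folklore] -/
theorem prob_const_one_id {G : Type u} [DecidableEq G] (A : Finset G) (x : G) :
    prob A (fun _ => (1 : ℝ)) id x = if x ∈ A then (A.card : ℝ)⁻¹ else 0 := by
  rw [prob_def, mass_def, mass_def, sum_const, sum_const, nsmul_eq_mul, nsmul_eq_mul, mul_one,
    mul_one]
  split_ifs with hx
  · have : A.filter (fun i => id i = x) = {x} := by
      ext y; simp only [mem_filter, id_eq, mem_singleton]
      exact ⟨fun h => h.2, fun h => ⟨h ▸ hx, h⟩⟩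
    rw [this, card_singleton, Nat.cast_one, one_div]
  · have : A.filter (fun i => id i = x) = ∅ := by
      rw [filter_eq_empty_iff]
      intro y hy hyx
      rw [id_eq] at hyx
      exact hx (hyx ▸ hy)
    rw [this, card_empty, Nat.cast_zero, zero_div]

variable {G : Type u} [AddCommGroup G] [Fintype G] [DecidableEq G] [Module (ZMod 2) G]

/-! ### Realising a `τ`-minimiser with independent copies; `k = 0` -/

/-- **GGMT Proposition 2.1, contrapositive, for laws**: a `τ`-minimiser (with `η = 1/9`) has
`d[μ₁ ; μ₂] = 0`. The four independent variables `X₁, X₂, X̃₁, X̃₂` of §3 are realised as the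
coordinates of `(G × G) × (G × G)` with weights `(μ₁ ⊗ μ₂) ⊗ (μ₁ ⊗ μ₂)`.
[cite: GowersEtAl2025, Proposition 2.1] -/
theorem dLaw_eq_zero_of_isTauMin_laws {ρ₁ ρ₂ μ₁ μ₂ : G → ℝ} (hρ₁ : ρ₁ ∈ stdSimplex ℝ G)
    (hρ₂ : ρ₂ ∈ stdSimplex ℝ G) (hμ₁ : μ₁ ∈ stdSimplex ℝ G) (hμ₂ : μ₂ ∈ stdSimplex ℝ G)
    (hmin : IsTauMin (1 / 9 : ℝ) ρ₁ ρ₂ μ₁ μ₂) : dLaw μ₁ μ₂ = 0 := by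
  -- the space
  have hw₁ := stdSimplex_nonneg hμ₁
  have hw₂ := stdSimplex_nonneg hμ₂
  have hs₁ := mass_univ_pos_of_mem_stdSimplex hμ₁
  have hs₂ := mass_univ_pos_of_mem_stdSimplex hμ₂
  set Q : G × G → ℝ := prodW μ₁ μ₂ with hQ
  have hQn : ∀ q ∈ (univ : Finset G) ×ˢ (univ : Finset G), 0 ≤ Q q := prodW_nonneg hw₁ hw₂
  have hQm : 0 < mass ((univ : Finset G) ×ˢ (univ : Finset G)) Q := mass_prod_pos hs₁ hs₂
  set P : (G × G) × (G × G) → ℝ := prodW Q Q with hP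
  have hPn : ∀ ω ∈ ((univ : Finset G) ×ˢ (univ : Finset G)) ×ˢ ((univ : Finset G) ×ˢ (univ : Finset G)),
      0 ≤ P ω := prodW_nonneg hQn hQn
  have hPm : 0 < mass (((univ : Finset G) ×ˢ (univ : Finset G)) ×ˢ
      ((univ : Finset G) ×ˢ (univ : Finset G))) P := mass_prod_pos hQm hQm
  -- laws on the factor `G × G`
  have q₁ : ∀ a, prob ((univ : Finset G) ×ˢ (univ : Finset G)) Q (fun q => q.1) a = μ₁ a := fun a => by
    rw [hQ, show (fun q : G × G => q.1) = fun q => id q.1 from rfl, prob_prod_fst id hs₂.ne',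
      prob_univ_id hμ₁.2]
  have q₂ : ∀ a, prob ((univ : Finset G) ×ˢ (univ : Finset G)) Q (fun q => q.2) a = μ₂ a := fun a => by
    rw [hQ, show (fun q : G × G => q.2) = fun q => id q.2 from rfl, prob_prod_snd id hs₁.ne',
      prob_univ_id hμ₂.2]
  -- laws of the four coordinates
  have l₁ : prob (((univ : Finset G) ×ˢ (univ : Finset G)) ×ˢ ((univ : Finset G) ×ˢ (univ : Finset G)))
      P (fun ω => ω.1.1) = μ₁ := by
    funext a; rw [hP, prob_prod_fst (fun q : G × G => q.1) hQm.ne', q₁]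
  have l₂ : prob (((univ : Finset G) ×ˢ (univ : Finset G)) ×ˢ ((univ : Finset G) ×ˢ (univ : Finset G)))
      P (fun ω => ω.1.2) = μ₂ := by
    funext a; rw [hP, prob_prod_fst (fun q : G × G => q.2) hQm.ne', q₂]
  have l₁' : prob (((univ : Finset G) ×ˢ (univ : Finset G)) ×ˢ ((univ : Finset G) ×ˢ (univ : Finset G)))
      P (fun ω => ω.2.1) = μ₁ := by
    funext a; rw [hP, prob_prod_snd (fun q : G × G => q.1) hQm.ne', q₁]
  have l₂' : prob (((univ : Finset G) ×ˢ (univ : Finset G)) ×ˢ ((univ : Finset G) ×ˢ (univ : Finset G)))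
      P (fun ω => ω.2.2) = μ₂ := by
    funext a; rw [hP, prob_prod_snd (fun q : G × G => q.2) hQm.ne', q₂]
  -- the three splittings
  have iA : IndepRV (((univ : Finset G) ×ˢ (univ : Finset G)) ×ˢ ((univ : Finset G) ×ˢ (univ : Finset G)))
      P (fun ω => (ω.1.1, ω.1.2)) (fun ω => (ω.2.1, ω.2.2)) :=
    indepRV_prod (fun q : G × G => (q.1, q.2)) (fun q : G × G => (q.1, q.2))
  have memΩ : ∀ ω : (G × G) × (G × G),
      ω ∈ ((univ : Finset G) ×ˢ (univ : Finset G)) ×ˢ ((univ : Finset G) ×ˢ (univ : Finset G)) :=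
    fun ω => by simp only [mem_product, mem_univ, and_self]
  have iB : IndepRV (((univ : Finset G) ×ˢ (univ : Finset G)) ×ˢ ((univ : Finset G) ×ˢ (univ : Finset G)))
      P (fun ω => (ω.1.1, ω.2.2)) (fun ω => (ω.1.2, ω.2.1)) := by
    refine indepRV_of_factorizes (fun p : G × G => μ₁ p.1 * μ₂ p.2) (fun p : G × G => μ₂ p.1 * μ₁ p.2)
      (fun ω _ => by simp only [hP, hQ, prodW_apply]; ring) (fun ω _ ω' _ h => ?_) ?_
    · simp only [Prod.mk.injEq] at h
      exact Prod.ext (Prod.ext h.1.1 h.2.1) (Prod.ext h.2.2 h.1.2)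
    · intro a _ b _
      exact ⟨((a.1, b.1), (b.2, a.2)), memΩ _, rfl, rfl⟩
  have iC : IndepRV (((univ : Finset G) ×ˢ (univ : Finset G)) ×ˢ ((univ : Finset G) ×ˢ (univ : Finset G)))
      P (fun ω => (ω.1.1, ω.2.1)) (fun ω => (ω.1.2, ω.2.2)) := by
    refine indepRV_of_factorizes (fun p : G × G => μ₁ p.1 * μ₁ p.2) (fun p : G × G => μ₂ p.1 * μ₂ p.2)
      (fun ω _ => by simp only [hP, hQ, prodW_apply]; ring) (fun ω _ ω' _ h => ?_) ?_
    · simp only [Prod.mk.injEq] at h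
      exact Prod.ext (Prod.ext h.1.1 h.2.1) (Prod.ext h.1.2 h.2.2)
    · intro a _ b _
      exact ⟨((a.1, b.1), (a.2, b.2)), memΩ _, rfl, rfl⟩
  exact dLaw_eq_zero_of_isTauMin hPn hPm l₁ l₂ l₁' l₂' iA iB iC hρ₁ hρ₂ hmin

/-! ### GGMT Theorem 1.8 (entropic PFR) -/

/-- **Entropic polynomial Freiman–Ruzsa theorem** (GGMT Theorem 1.8, for laws): for any two
laws `ρ₁, ρ₂` on an elementary abelian `2`-group `G` there is a subgroup `H ≤ G` with
`d[ρ₁ ; U_H] + d[ρ₂ ; U_H] ≤ 11 d[ρ₁ ; ρ₂]`, where `U_H` is the uniform distribution on `H`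
(realised as the identity on the finite set `T = H` with unit weights).
[cite: GowersEtAl2025, Theorem 1.8] -/
theorem entropic_pfr {ρ₁ ρ₂ : G → ℝ} (hρ₁ : ρ₁ ∈ stdSimplex ℝ G) (hρ₂ : ρ₂ ∈ stdSimplex ℝ G) :
    ∃ (H : AddSubgroup G) (T : Finset G), (∀ x, x ∈ T ↔ x ∈ H) ∧
      rdist univ ρ₁ id T (fun _ => (1 : ℝ)) id + rdist univ ρ₂ id T (fun _ => (1 : ℝ)) id ≤
        11 * dLaw ρ₁ ρ₂ := by
  obtain ⟨μ₁, μ₂, hμ₁, hμ₂, hmin⟩ := isTauMin_exists (1 / 9 : ℝ) ρ₁ ρ₂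
  have hk := dLaw_eq_zero_of_isTauMin_laws hρ₁ hρ₂ hμ₁ hμ₂ hmin
  obtain ⟨H, T, hT, d₁, d₂⟩ := exists_subgroup_of_dLaw_eq_zero hμ₁ hμ₂ hk
  refine ⟨H, T, hT, ?_⟩
  -- `τ[μ₁ ; μ₂] ≤ τ[ρ₂ ; ρ₁] = (1 + 2η) d[ρ₁ ; ρ₂]`
  have hτ := hmin ρ₂ ρ₁ hρ₂ hρ₁
  rw [tauLaw_def, tauLaw_def, hk, dLaw_comm ρ₂ ρ₁] at hτ
  -- triangle inequality through `μ₁`, `μ₂`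
  have hw₁ := stdSimplex_nonneg hρ₁
  have hw₂ := stdSimplex_nonneg hρ₂
  have hs₁ := mass_univ_pos_of_mem_stdSimplex hρ₁
  have hs₂ := mass_univ_pos_of_mem_stdSimplex hρ₂
  have hv₁ := stdSimplex_nonneg hμ₁
  have hv₂ := stdSimplex_nonneg hμ₂
  have ht₁ := mass_univ_pos_of_mem_stdSimplex hμ₁
  have ht₂ := mass_univ_pos_of_mem_stdSimplex hμ₂
  have hTne : T.Nonempty := ⟨0, (hT 0).2 H.zero_mem⟩
  have hwT : ∀ x ∈ T, (0 : ℝ) ≤ (fun _ => (1 : ℝ)) x := fun _ _ => zero_le_one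
  have hsT : 0 < mass T (fun _ => (1 : ℝ)) := mass_pos (fun _ _ => one_pos) hTne
  have t₁ := rdist_triangle (id : G → G) (id : G → G) (id : G → G) hw₁ hs₁ hv₁ ht₁ hwT hsT
  have t₂ := rdist_triangle (id : G → G) (id : G → G) (id : G → G) hw₂ hs₂ hv₂ ht₂ hwT hsT
  have e₁ : rdist univ ρ₁ id univ μ₁ id = dLaw ρ₁ μ₁ := by
    rw [rdist_univ_id hρ₁, funext (prob_univ_id hμ₁.2)]
  have e₂ : rdist univ ρ₂ id univ μ₂ id = dLaw ρ₂ μ₂ := by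
    rw [rdist_univ_id hρ₂, funext (prob_univ_id hμ₂.2)]
  rw [d₁, e₁] at t₁
  rw [d₂, e₂] at t₂
  norm_num at hτ
  linarith

/-! ### From entropic PFR to PFR (GGMT Appendix B) -/

open scoped Pointwise

/-- **PFR from entropic PFR** (GGMT Appendix B with `C' = 11`): if `A ⊆ G` is nonempty with
`|A + A| ≤ K |A|` in an elementary abelian `2`-group `G`, then `A` is covered by at most `2 K¹²`
translates of a subgroup `H` with `|H| ≤ |A|`. [cite: GowersEtAl2025, Appendix B] -/
theorem pfr_of_entropic_pfr {A : Finset G} (hA : A.Nonempty) {K : ℝ}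
    (hK : ((A + A).card : ℝ) ≤ K * A.card) :
    ∃ (H : AddSubgroup G) (c : Finset G), (c.card : ℝ) ≤ 2 * K ^ 12 ∧ Nat.card H ≤ A.card ∧
      ∀ a ∈ A, ∃ x ∈ c, a - x ∈ H := by
  classical
  ----------------------------------------------------------------------------------------------
  -- Step 0: positivity
  ----------------------------------------------------------------------------------------------
  have hAcard : (0 : ℝ) < A.card := by exact_mod_cast card_pos.2 hA
  have hAA : (A.card : ℝ) ≤ (A + A).card := by exact_mod_cast card_le_card_add_right hA
  have hK1 : 1 ≤ K := by
    by_contra h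
    rw [not_le] at h
    have : K * A.card < 1 * A.card := mul_lt_mul_of_pos_right h hAcard
    linarith
  have hK0 : 0 < K := lt_of_lt_of_le one_pos hK1
  have hlogK : 0 ≤ Real.log K := Real.log_nonneg hK1
  ----------------------------------------------------------------------------------------------
  -- Step 1: the uniform law `ρ = U_A`; `H[ρ] = log |A|`; `d[ρ ; ρ] ≤ log K`
  ----------------------------------------------------------------------------------------------
  set ρ : G → ℝ := prob A (fun _ => (1 : ℝ)) id with hρdef
  have hwA : ∀ x ∈ A, (0 : ℝ) ≤ (fun _ => (1 : ℝ)) x := fun _ _ => zero_le_one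
  have hsA : 0 < mass A (fun _ => (1 : ℝ)) := mass_pos (fun _ _ => one_pos) hA
  have hρ : ρ ∈ stdSimplex ℝ G := prob_mem_stdSimplex hwA hsA id
  have eA : ent A (fun _ => (1 : ℝ)) id = Real.log A.card :=
    ent_eq_log_card_of_uniform one_pos (fun _ _ => rfl) (Set.injOn_id _)
  have hentρ : entFun ρ = Real.log A.card := by rw [hρdef, ← ent_eq_entFun, eA]
  have hdρ : dLaw ρ ρ ≤ Real.log K := by
    have h1 : dLaw ρ ρ = rdist A (fun _ => (1 : ℝ)) id A (fun _ => (1 : ℝ)) id := rfl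
    rw [h1, rdist_eq_ent_prod id id hsA hsA, eA]
    have hsub : (A ×ˢ A).image (fun p : G × G => id p.1 + id p.2) ⊆ A + A := by
      intro z hz
      obtain ⟨p, hp, rfl⟩ := mem_image.1 hz
      exact add_mem_add (mem_product.1 hp).1 (mem_product.1 hp).2
    have h2 := ent_le_log_card (prodW_nonneg hwA hwA) hsub
    have h3 : Real.log ((A + A).card : ℝ) ≤ Real.log K + Real.log A.card := by
      rw [← Real.log_mul hK0.ne' hAcard.ne']
      exact Real.log_le_log (by linarith) hK
    linarith
  ----------------------------------------------------------------------------------------------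
  -- Step 2: entropic PFR; `d = d[ρ ; U_H] ≤ (11/2) log K`; `|log |H| - log |A|| ≤ 11 log K`
  ----------------------------------------------------------------------------------------------
  obtain ⟨H, T, hT, hsum⟩ := entropic_pfr hρ hρ
  set d := rdist univ ρ id T (fun _ => (1 : ℝ)) id with hddef
  have hd : d ≤ 11 / 2 * Real.log K := by linarith
  have hTne : T.Nonempty := ⟨0, (hT 0).2 H.zero_mem⟩
  have hTcard : (0 : ℝ) < T.card := by exact_mod_cast card_pos.2 hTne
  have hwT : ∀ x ∈ T, (0 : ℝ) ≤ (fun _ => (1 : ℝ)) x := fun _ _ => zero_le_one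
  have hsT : 0 < mass T (fun _ => (1 : ℝ)) := mass_pos (fun _ _ => one_pos) hTne
  have eT : ent T (fun _ => (1 : ℝ)) id = Real.log T.card :=
    ent_eq_log_card_of_uniform one_pos (fun _ _ => rfl) (Set.injOn_id _)
  have hwρ := stdSimplex_nonneg hρ
  have hsρ := mass_univ_pos_of_mem_stdSimplex hρ
  have eρ : ent univ ρ id = Real.log A.card := by
    rw [ent_eq_entFun, funext (prob_univ_id hρ.2), hentρ]
  have habs := abs_ent_sub_ent_le_two_mul_rdist (id : G → G) (id : G → G) hwρ hsρ hwT hsT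
  rw [eρ, eT, ← hddef] at habs
  have hTA : Real.log T.card ≤ Real.log A.card + 11 * Real.log K := by
    have := neg_abs_le (Real.log A.card - Real.log T.card); linarith
  have hAT : Real.log A.card ≤ Real.log T.card + 11 * Real.log K := by
    have := le_abs_self (Real.log A.card - Real.log T.card); linarith
  ----------------------------------------------------------------------------------------------
  -- Step 3: a popular translate `x₀` (GGMT (A.2)): `ν = law of U_A - U_H`, `ν x₀ ≥ e^{-H[ν]}`
  ----------------------------------------------------------------------------------------------
  set U : G → ℝ := prob T (fun _ => (1 : ℝ)) id with hUdef
  set ν : G → ℝ := subLaw ρ U with hνdef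
  have hν_ent : entFun ν = d + Real.log A.card / 2 + Real.log T.card / 2 := by
    have h1 : d = dLaw ρ U := by rw [hddef, rdist_univ_id hρ]
    rw [h1, dLaw, ← hνdef, hentρ]
    have : entFun U = Real.log T.card := by rw [hUdef, ← ent_eq_entFun, eT]
    rw [this]; ring
  -- realise `ν` as the law of `p ↦ p.1 + p.2` on `A × T`
  have hνlaw : ∀ z, prob (A ×ˢ T) (prodW (fun _ => (1 : ℝ)) (fun _ => (1 : ℝ)))
      (fun p : G × G => id p.1 + id p.2) z = ν z := by
    intro z
    rw [(indepRV_prod (s := A) (w := fun _ => (1 : ℝ)) (t := T) (v := fun _ => (1 : ℝ)) id id).prob_add,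
      funext (prob_prod_fst (s := A) (w := fun _ => (1 : ℝ)) (t := T) (v := fun _ => (1 : ℝ)) id hsT.ne'),
      funext (prob_prod_snd (s := A) (w := fun _ => (1 : ℝ)) (t := T) (v := fun _ => (1 : ℝ)) id hsA.ne')]
  obtain ⟨x₀, -, hx₀⟩ := exists_max_image univ ν univ_nonempty
  have hνx₀ : -(d + Real.log A.card / 2 + Real.log T.card / 2) ≤ Real.log (ν x₀) := by
    have h1 := neg_log_le_ent (X := fun p : G × G => id p.1 + id p.2) (prodW_nonneg hwA hwT)
      (mass_prod_pos hsA hsT) (q := ν x₀) fun z _ => by rw [hνlaw]; exact hx₀ z (mem_univ z)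
    rw [ent_eq_entFun, funext hνlaw, hν_ent] at h1
    linarith
  -- `ν x₀ = |{y ∈ T : x₀ + y ∈ A}| / (|A| |T|)`
  set Bf := T.filter (fun y => x₀ + y ∈ A) with hBf
  have hνval : ν x₀ = (Bf.card : ℝ) * ((A.card : ℝ)⁻¹ * (T.card : ℝ)⁻¹) := by
    rw [hνdef]
    unfold subLaw
    simp_rw [hρdef, hUdef, prob_const_one_id, ite_mul, zero_mul, mul_ite, mul_zero]
    rw [← sum_filter, ← sum_filter, filter_filter, sum_const, nsmul_eq_mul, hBf]
    congr 3
    ext y; simp only [mem_filter, mem_univ, true_and]; tauto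
  have hBfpos : 0 < Bf.card := by
    by_contra h0
    rw [not_lt, Nat.le_zero] at h0
    have hν0 : ν x₀ = 0 := by rw [hνval, h0, Nat.cast_zero, zero_mul]
    -- but `∑ ν = 1`
    have hs1 : ∑ z, ν z = 1 := by
      rw [← funext hνlaw]; exact sum_univ_prob_eq_one (mass_prod_pos hsA hsT) _
    have hle : ∑ z, ν z ≤ ∑ _z : G, (0 : ℝ) :=
      sum_le_sum fun z _ => (hx₀ z (mem_univ z)).trans (le_of_eq hν0)
    rw [hs1, sum_const_zero] at hle
    exact absurd hle (by norm_num)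
  have hBfcard : (0 : ℝ) < Bf.card := by exact_mod_cast hBfpos
  have hlogBf : (Real.log A.card + Real.log T.card) / 2 - 11 / 2 * Real.log K ≤ Real.log Bf.card := by
    have h1 : Real.log (ν x₀) = Real.log Bf.card - Real.log A.card - Real.log T.card := by
      rw [hνval, Real.log_mul hBfcard.ne' (mul_ne_zero (inv_ne_zero hAcard.ne') (inv_ne_zero hTcard.ne')),
        Real.log_mul (inv_ne_zero hAcard.ne') (inv_ne_zero hTcard.ne'), Real.log_inv, Real.log_inv]
      ring
    linarith
  ----------------------------------------------------------------------------------------------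
  -- Step 4: Ruzsa covering with `B = A ∩ (x₀ + H)`
  ----------------------------------------------------------------------------------------------
  set B := Bf.image (fun y => x₀ + y) with hBdef
  have hBcard : B.card = Bf.card := card_image_of_injective _ (add_right_injective x₀)
  have hBne : B.Nonempty := by rw [← card_pos, hBcard]; exact hBfpos
  have hBA : B ⊆ A := by
    intro b hb
    obtain ⟨y, hy, rfl⟩ := mem_image.1 hb
    exact (mem_filter.1 hy).2
  have hBB : ∀ b₁ ∈ B, ∀ b₂ ∈ B, b₁ - b₂ ∈ H := by
    intro b₁ hb₁ b₂ hb₂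
    obtain ⟨y₁, hy₁, rfl⟩ := mem_image.1 hb₁
    obtain ⟨y₂, hy₂, rfl⟩ := mem_image.1 hb₂
    rw [add_sub_add_left_eq_sub]
    exact H.sub_mem ((hT y₁).1 (mem_filter.1 hy₁).1) ((hT y₂).1 (mem_filter.1 hy₂).1)
  have hBcardR : (0 : ℝ) < B.card := by rw [hBcard]; exact hBfcard
  have hcov : ((A + B).card : ℝ) ≤ (K * A.card / B.card) * B.card := by
    rw [div_mul_cancel₀ _ hBcardR.ne']
    refine le_trans ?_ hK
    exact_mod_cast card_le_card (add_subset_add_left hBA)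
  obtain ⟨F, hFA, hFcard, hAF⟩ := ruzsa_covering_add hBne hcov
  have hFcov : ∀ a ∈ A, ∃ f ∈ F, a - f ∈ H := by
    intro a ha
    obtain ⟨f, hf, z, hz, hfz⟩ := mem_add.1 (hAF ha)
    obtain ⟨b₁, hb₁, b₂, hb₂, rfl⟩ := mem_sub.1 hz
    refine ⟨f, hf, ?_⟩
    rw [← hfz, add_sub_cancel_left]
    exact hBB b₁ hb₁ b₂ hb₂
  have hFne : F.Nonempty := by
    obtain ⟨a, ha⟩ := hA
    obtain ⟨f, hf, -⟩ := hFcov a ha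
    exact ⟨f, hf⟩
  have hFcardpos : (0 : ℝ) < F.card := by exact_mod_cast card_pos.2 hFne
  have hlogF : Real.log F.card ≤ 13 / 2 * Real.log K + (Real.log A.card - Real.log T.card) / 2 := by
    have h1 : Real.log F.card ≤ Real.log K + Real.log A.card - Real.log B.card := by
      rw [← Real.log_mul hK0.ne' hAcard.ne', ← Real.log_div (mul_ne_zero hK0.ne' hAcard.ne') hBcardR.ne']
      exact Real.log_le_log hFcardpos hFcard
    rw [hBcard] at h1
    linarith
  ----------------------------------------------------------------------------------------------
  -- Step 5: the two cases `|H| ≤ |A|` and `|H| > |A|`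
  ----------------------------------------------------------------------------------------------
  have hHcard : Nat.card H = T.card := Nat.subtype_card T hT
  have hexp12 : Real.exp (12 * Real.log K) = K ^ 12 := by
    rw [show (12 : ℝ) * Real.log K = Real.log (K ^ 12) by rw [Real.log_pow]; norm_num,
      Real.exp_log (pow_pos hK0 12)]
  by_cases hcase : T.card ≤ A.card
  · refine ⟨H, F, ?_, hHcard ▸ hcase, hFcov⟩
    have h1 : Real.log F.card ≤ 12 * Real.log K := by linarith
    have h2 : (F.card : ℝ) ≤ K ^ 12 := by
      rw [← hexp12, ← Real.exp_log hFcardpos]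
      exact Real.exp_le_exp.2 h1
    have h3 : (0 : ℝ) ≤ K ^ 12 := pow_nonneg hK0.le 12
    linarith
  · rw [not_le] at hcase
    -- a subgroup `H' ≤ H` with `|A|/2 < |H'| ≤ |A|`
    have hAk : A.card ≤ Nat.card (AddSubgroup.toZModSubmodule 2 H) := by
      rw [show Nat.card (AddSubgroup.toZModSubmodule 2 H) = Nat.card H from rfl, hHcard]
      exact hcase.le
    obtain ⟨H', hH'le, hH'lt, hH'H⟩ := ZModModule.exists_submodule_subset_card_le Nat.prime_two
      (AddSubgroup.toZModSubmodule 2 H) hAk (card_pos.2 hA).ne'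
    set H'' : AddSubgroup G := H'.toAddSubgroup with hH''
    have hH''card : Nat.card H'' = Nat.card H' := rfl
    have hmemH'' : ∀ x, x ∈ H'' → x ∈ H := fun x hx => hH'H hx
    obtain ⟨T', hT'⟩ : ∃ T' : Finset G, ∀ x, x ∈ T' ↔ x ∈ H'' :=
      ⟨univ.filter (· ∈ H''), fun x => by rw [mem_filter]; exact ⟨fun h => h.2, fun h => ⟨mem_univ _, h⟩⟩⟩
    have hT'card : Nat.card H'' = T'.card := Nat.subtype_card T' hT'
    have hT'ne : T'.Nonempty := ⟨0, (hT' 0).2 H''.zero_mem⟩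
    have hT'cardpos : (0 : ℝ) < T'.card := by exact_mod_cast card_pos.2 hT'ne
    -- cover `T` by `|T|/|T'|` translates of `T' - T'`
    have hcov2 : ((T + T').card : ℝ) ≤ ((T.card : ℝ) / T'.card) * T'.card := by
      rw [div_mul_cancel₀ _ hT'cardpos.ne']
      have : T + T' ⊆ T := by
        intro z hz
        obtain ⟨t, ht, t', ht', rfl⟩ := mem_add.1 hz
        exact (hT _).2 (H.add_mem ((hT t).1 ht) (hmemH'' t' ((hT' t').1 ht')))
      exact_mod_cast card_le_card this
    obtain ⟨R, hRT, hRcard, hTR⟩ := ruzsa_covering_add hT'ne hcov2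
    have hRne : R.Nonempty := by
      obtain ⟨r, hr, -⟩ := mem_add.1 (hTR ((hT 0).2 H.zero_mem))
      exact ⟨r, hr⟩
    have hRcardpos : (0 : ℝ) < R.card := by exact_mod_cast card_pos.2 hRne
    refine ⟨H'', F + R, ?_, ?_, ?_⟩
    · -- `|F + R| < 2 K ^ 12`
      have h1 : ((F + R).card : ℝ) ≤ F.card * R.card := by exact_mod_cast card_add_le
      have hlt : (A.card : ℝ) < 2 * T'.card := by
        rw [← hT'card, hH''card]; exact_mod_cast hH'lt
      have hlogR : Real.log R.card ≤ Real.log T.card - Real.log T'.card := by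
        rw [← Real.log_div hTcard.ne' hT'cardpos.ne']
        exact Real.log_le_log hRcardpos hRcard
      have hlogA2 : Real.log A.card < Real.log 2 + Real.log T'.card := by
        rw [← Real.log_mul two_ne_zero hT'cardpos.ne']
        exact Real.log_lt_log hAcard hlt
      have h2 : Real.log ((F.card : ℝ) * R.card) < 12 * Real.log K + Real.log 2 := by
        rw [Real.log_mul hFcardpos.ne' hRcardpos.ne']
        linarith
      have h3 : (F.card : ℝ) * R.card < 2 * K ^ 12 := by
        rw [← Real.exp_log (mul_pos hFcardpos hRcardpos), ← hexp12,
          ← Real.exp_log (show (0 : ℝ) < 2 by norm_num), ← Real.exp_add]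
        refine Real.exp_lt_exp.2 ?_
        linarith
      linarith
    · rw [hH''card]
      exact hH'le
    · intro a ha
      obtain ⟨f, hf, haf⟩ := hFcov a ha
      obtain ⟨r, hr, z, hz, hrz⟩ := mem_add.1 (hTR ((hT _).2 haf))
      obtain ⟨t₁, ht₁, t₂, ht₂, rfl⟩ := mem_sub.1 hz
      refine ⟨f + r, add_mem_add hf hr, ?_⟩
      have : a - (f + r) = t₁ - t₂ := by rw [← sub_sub, ← hrz]; abel
      rw [this]
      exact H''.sub_mem ((hT' t₁).1 ht₁) ((hT' t₂).1 ht₂)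

end EntropicRuzsa

/-- **The polynomial Freiman–Ruzsa theorem over `𝔽₂ⁿ`** (Marton's conjecture; GGMT Theorem 1.2,
`C = 12`), discharging the named fact `polynomialFreimanRuzsa`: the entropic PFR theorem
(`EntropicRuzsa.entropic_pfr`, GGMT Theorem 1.8) combined with GGMT Appendix B
(`EntropicRuzsa.pfr_of_entropic_pfr`), specialised to `G = Fin n → ZMod 2`.
[cite: GowersEtAl2025, Theorem 1.2] -/
theorem polynomialFreimanRuzsa_holds : polynomialFreimanRuzsa := by
  intro n A K hA hK
  exact EntropicRuzsa.pfr_of_entropic_pfr hA hK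


end Literature.Combinatorics.Additive

end
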